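import Literature.AlgebraicGeometry.Motives.ProjectiveOfGeneratingSections
import Mathlib.AlgebraicGeometry.ResidueField
import HarnessLib

/-!
# Sections of the powers `𝓛^{⊗d}` in chart form: algebra, non-vanishing loci, quotients, and graded prime avoidance

For generating-sections data `D : Literature.GeneratingSections ι Y` on a scheme `Y` (the opens
`U i = Y_{sᵢ}` and ratios `s_j/s_i` of sections generating an invertible sheaf `𝓛`;
`Motives/MorphismsToProjectiveSpace`) and the sections `t : D.Sec d` of `𝓛^{⊗d}` in chart form
(`Motives/ProjectiveOfGeneratingSections`), this file adds what the descent of projectivity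
along a finite extension of the base field (`Motives/ProjectiveDescentFinite`) needs:

* the algebra of sections: `Sec.add`, `Sec.zero`, `Sec.sum`, `Sec.prod`, `Sec.npow`,
  `Sec.monomial` (the sections `∏ sᵢ^{γᵢ}` of `𝓛^{⊗|γ|}`);
* `Sec.Nonvanishing t x` (the section does not vanish at the point `x`, chart-independent by
  `Sec.basicOpen_val_inf`), with its calculus, and the open non-vanishing locus `D.XF t = Y_t`;
* `D.quot t t₀ Ω hΩ ∈ Γ(Y, Ω)`: **the quotient `t/t₀` of two sections of `𝓛^{⊗d}` on an open
  `Ω ⊆ Y_{t₀}`**, glued (sheaf property of `𝒪_Y`) from the local quotients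
  `(t/sᵢ^d)(t₀/sᵢ^d)⁻¹` on `Ω ∩ Y_{t₀/sᵢ^d}`; `quot_self`, `rs_quot_of_le`, `basicOpen_quot`
  (`Y_{t/t₀} = Ω ∩ Y_t`) and the change-of-denominator rule `quot_trans`
  (`t/t₂ = (t₁/t₂)(t/t₁)`) — i.e. the functions obtained by trivialising `𝓛^{⊗d}` by `t₀`;
* `exists_sec_nonvanishing` (**graded prime avoidance**): if the `U i` are affine and `ι` is
  finite, then for a finite set `S` of points no two of which specialise to each other there is
  a section of some `𝓛^{⊗d}`, `d > 0`, vanishing at no point of `S`. This is the chart-wise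
  core case of Görtz–Wedhorn I, Prop. 13.49 (p. 496), whose proof rests on prime ideal
  avoidance, Prop. B.2 (2) (p. 696); the printed 13.49 has no non-specialisation hypothesis
  and moreover produces `X_f` affine inside a given neighbourhood — neither refinement is
  needed or proved here. In the language of sections: for each `a ∈ S` a product of sections
  vanishing at the other points of `S` but not at `a` — found chartwise in the affine `U i` by
  ordinary prime avoidance and extended by `exists_sec_val_eq`, or the section `sᵢ` itself —,
  times `sₐ`, brought to a common degree and summed.

## References

* U. Görtz, T. Wedhorn, *Algebraic Geometry I: Schemes*, 2nd ed., Springer Spektrum (2020),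
  doi:10.1007/978-3-658-30733-2: Thm. 7.22 (p. 230), Prop. 13.49 (p. 496) (finitely many points
  of a quasi-projective scheme lie in a common affine `X_f`), Prop. B.2 (2) (p. 696, prime ideal
  avoidance), (13.15)–(13.16). [GortzWedhorn2020]
* R. Hartshorne, *Algebraic Geometry*, GTM 52 (1977): II Thm. 7.1, proof of II Thm. 7.6.
  [Hartshorne1977]
-/

universe u

open CategoryTheory AlgebraicGeometry Limits Opposite TopologicalSpace

noncomputable section

namespace Literature.AlgebraicGeometry.Motives

namespace GeneratingSections

variable {ι : Type} {Y : Scheme.{u}} (D : GeneratingSections ι Y)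

namespace Sec

variable {D} {d : ℕ}

/-! ### Algebra of sections -/

/-- The sum of two sections of `𝓛^{⊗d}`. [folklore] -/
def add (t t' : D.Sec d) : D.Sec d where
  val i := t.val i + t'.val i
  compat i j := by rw [map_add, map_add, t.compat, t'.compat, add_mul]

/-- Chart values of a sum. [folklore] -/
@[simp] theorem add_val (t t' : D.Sec d) (i : ι) : (t.add t').val i = t.val i + t'.val i := rfl

/-- The zero section of `𝓛^{⊗d}`. [folklore] -/
def zero : D.Sec d where
  val _ := 0
  compat i j := by rw [map_zero, map_zero, zero_mul]

/-- Chart values of the zero section. [folklore] -/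
@[simp] theorem zero_val (i : ι) : (zero : D.Sec d).val i = 0 := rfl

/-- A finite sum of sections of `𝓛^{⊗d}`. [folklore] -/
def sum {β : Type*} (s : Finset β) (f : β → D.Sec d) : D.Sec d where
  val i := ∑ b ∈ s, (f b).val i
  compat i j := by
    rw [map_sum, map_sum, Finset.sum_mul]
    exact Finset.sum_congr rfl fun b _ => (f b).compat i j

/-- Chart values of a finite sum. [folklore] -/
@[simp] theorem sum_val {β : Type*} (s : Finset β) (f : β → D.Sec d) (i : ι) :
    (sum s f).val i = ∑ b ∈ s, (f b).val i := rfl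

/-- A finite product of sections of `𝓛^{⊗d}` (a section of `𝓛^{⊗(d · #s)}`). [folklore] -/
def prod {β : Type*} (s : Finset β) (f : β → D.Sec d) : D.Sec (d * s.card) where
  val i := ∏ b ∈ s, (f b).val i
  compat i j := by
    rw [map_prod, map_prod, pow_mul, ← Finset.prod_const, ← Finset.prod_mul_distrib]
    exact Finset.prod_congr rfl fun b _ => (f b).compat i j

/-- Chart values of a finite product. [folklore] -/
@[simp] theorem prod_val {β : Type*} (s : Finset β) (f : β → D.Sec d) (i : ι) :
    (prod s f).val i = ∏ b ∈ s, (f b).val i := rfl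

/-- Powers of a section. [folklore] -/
def npow (t : D.Sec d) (n : ℕ) : D.Sec (d * n) where
  val i := t.val i ^ n
  compat i j := by rw [map_pow, map_pow, t.compat, mul_pow, ← pow_mul]

/-- Chart values of a power. [folklore] -/
@[simp] theorem npow_val (t : D.Sec d) (n : ℕ) (i : ι) : (t.npow n).val i = t.val i ^ n := rfl

variable (D) in
/-- The monomial section `∏ᵢ sᵢ^{γᵢ}` of `𝓛^{⊗|γ|}`. [folklore] -/
def monomial [Fintype ι] (γ : ι → ℕ) : D.Sec (∑ i, γ i) where
  val j := ∏ l, D.ratio j l ^ γ l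
  compat i j := by
    rw [map_prod, map_prod]
    simp_rw [map_pow]
    conv_lhs => arg 2; ext l; rw [D.ratio_right_eq i j l, mul_pow]
    rw [Finset.prod_mul_distrib, Finset.prod_pow_eq_pow_sum, mul_comm]

/-- Chart values of a monomial section. [folklore] -/
@[simp] theorem monomial_val [Fintype ι] (γ : ι → ℕ) (j : ι) :
    (monomial D γ).val j = ∏ l, D.ratio j l ^ γ l := rfl

/-- The monomial with exponent `M · eᵢ` is `sᵢ^{⊗M}`. [folklore] -/
theorem monomial_single_val [Fintype ι] [DecidableEq ι] (i : ι) (M : ℕ) (j : ι) :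
    (monomial D (Pi.single i M)).val j = D.ratio j i ^ M := by
  rw [monomial_val, Finset.prod_eq_single i (fun l _ hl => by rw [Pi.single_eq_of_ne hl, pow_zero])
    (fun h => absurd (Finset.mem_univ i) h), Pi.single_eq_same]

/-- The monomial with exponent `e_j + (M-1) · eᵢ` has `i`-th chart value `s_j/sᵢ`. [folklore] -/
theorem monomial_single_add_val [Fintype ι] [DecidableEq ι] (i j : ι) (M : ℕ) :
    (monomial D (Pi.single j 1 + Pi.single i M)).val i = D.ratio i j := by
  rw [monomial_val]
  simp_rw [Pi.add_apply, pow_add]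
  rw [Finset.prod_mul_distrib,
    Finset.prod_eq_single j (fun l _ hl => by rw [Pi.single_eq_of_ne hl, pow_zero])
      (fun h => absurd (Finset.mem_univ j) h),
    Finset.prod_eq_single i (fun l _ hl => by rw [Pi.single_eq_of_ne hl, pow_zero])
      (fun h => absurd (Finset.mem_univ i) h),
    Pi.single_eq_same, Pi.single_eq_same, pow_one, D.ratio_self, one_pow, mul_one]

/-! ### Non-vanishing of a section at a point -/

/-- The section `t` does not vanish at `x`: `x` lies in the non-vanishing locus of some (any)
chart value of `t`. [folklore] -/
def Nonvanishing (t : D.Sec d) (x : Y) : Prop := ∃ i, x ∈ Y.basicOpen (t.val i)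

/-- Non-vanishing can be tested in any chart containing the point. [folklore] -/
theorem nonvanishing_iff (t : D.Sec d) {x : Y} {i : ι} (hx : x ∈ D.U i) :
    t.Nonvanishing x ↔ x ∈ Y.basicOpen (t.val i) := by
  constructor
  · rintro ⟨j, hj⟩
    have h : x ∈ Y.basicOpen (t.val j) ⊓ D.U i := ⟨hj, hx⟩
    rw [t.basicOpen_val_inf j i] at h
    exact h.1
  · exact fun h => ⟨i, h⟩

/-- Every point lies in some chart. This duplicates `Literature.AlgebraicGeometry.Motives.GeneratingSections.exists_mem_U`
(`Motives/AbelianVarietyDegree.lean`, a high-level abelian-variety file that this low-level file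
cannot import); that copy should be retired in favour of this one (librarian refactor requested
in the proposal note). [folklore] -/
theorem _root_.Literature.AlgebraicGeometry.Motives.GeneratingSections.exists_index_mem_U (x : Y) : ∃ i, x ∈ D.U i := by
  have hx : x ∈ (⊤ : Y.Opens) := trivial
  rw [← D.iSup_U, Opens.mem_iSup] at hx
  exact hx

/-- Non-vanishing in terms of the evaluation at the point. [folklore] -/
theorem nonvanishing_iff_evaluation_ne_zero (t : D.Sec d) {x : Y} {i : ι} (hx : x ∈ D.U i) :
    t.Nonvanishing x ↔ Y.evaluation (D.U i) x hx (t.val i) ≠ 0 := by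
  rw [t.nonvanishing_iff hx, Y.evaluation_ne_zero_iff_mem_basicOpen]

/-- `s_l^{⊗d}` does not vanish on `U l`. [folklore] -/
theorem nonvanishing_pow {x : Y} {l : ι} (hx : x ∈ D.U l) (d : ℕ) :
    (pow D l d).Nonvanishing x := by
  refine ⟨l, ?_⟩
  rw [pow_val_self, Y.basicOpen_of_isUnit isUnit_one]
  exact hx

/-- `s_l^{⊗d}`, `d ≠ 0`, vanishes off `U l`. [folklore] -/
theorem mem_U_of_nonvanishing_pow {x : Y} {l : ι} {d : ℕ} (hd : d ≠ 0)
    (h : (pow D l d).Nonvanishing x) : x ∈ D.U l := by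
  obtain ⟨i, hi⟩ := h
  rw [pow_val, Y.basicOpen_pow _ (Nat.pos_of_ne_zero hd), D.basicOpen_ratio] at hi
  exact hi.2

/-- A product does not vanish iff no factor does. [folklore] -/
theorem nonvanishing_mul_iff {e : ℕ} (t : D.Sec d) (t' : D.Sec e) (x : Y) :
    (t.mul t').Nonvanishing x ↔ t.Nonvanishing x ∧ t'.Nonvanishing x := by
  obtain ⟨i, hx⟩ := D.exists_index_mem_U x
  rw [(t.mul t').nonvanishing_iff hx, t.nonvanishing_iff hx, t'.nonvanishing_iff hx, mul_val,
    Scheme.basicOpen_mul]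
  exact Iff.rfl

/-- A finite product does not vanish iff no factor does. [folklore] -/
theorem nonvanishing_prod_iff {β : Type*} (s : Finset β) (f : β → D.Sec d) (x : Y) :
    (prod s f).Nonvanishing x ↔ ∀ b ∈ s, (f b).Nonvanishing x := by
  obtain ⟨i, hx⟩ := D.exists_index_mem_U x
  simp_rw [Sec.nonvanishing_iff_evaluation_ne_zero _ hx, prod_val, map_prod,
    Finset.prod_ne_zero_iff]

/-- A power of a non-vanishing section does not vanish (any exponent, including `0`).
[folklore] -/
theorem nonvanishing_npow (t : D.Sec d) (n : ℕ) {x : Y} (h : t.Nonvanishing x) :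
    (t.npow n).Nonvanishing x := by
  obtain ⟨i, hx⟩ := D.exists_index_mem_U x
  rw [Sec.nonvanishing_iff_evaluation_ne_zero _ hx] at h ⊢
  rw [npow_val, map_pow]
  exact pow_ne_zero n h

/-- Transport along `cast` does not change non-vanishing. [folklore] -/
@[simp] theorem nonvanishing_cast_iff {e : ℕ} (h : d = e) (t : D.Sec d) (x : Y) :
    (t.cast h).Nonvanishing x ↔ t.Nonvanishing x := Iff.rfl

/-- A sum of sections all but one of which vanish at `x`, the remaining one not, does not vanish
at `x`. [folklore] -/
theorem nonvanishing_sum_of_unique {β : Type*} (s : Finset β) (f : β → D.Sec d) (x : Y) (b₀ : β)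
    (hb₀ : b₀ ∈ s) (h₀ : (f b₀).Nonvanishing x) (h : ∀ b ∈ s, b ≠ b₀ → ¬(f b).Nonvanishing x) :
    (sum s f).Nonvanishing x := by
  classical
  obtain ⟨i, hx⟩ := D.exists_index_mem_U x
  simp_rw [Sec.nonvanishing_iff_evaluation_ne_zero _ hx] at h₀ h ⊢
  rw [sum_val, map_sum, Finset.sum_eq_single b₀ (fun b hb hne => not_not.mp (h b hb hne))
    (fun hb => absurd hb₀ hb)]
  exact h₀

end Sec

/-! ### The non-vanishing locus of a section and the quotient of two sections -/

section Quot

variable {d : ℕ}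

/-- The non-vanishing locus `Y_t = ⋃ᵢ Y_{t/sᵢ^d}` of a section `t` of `𝓛^{⊗d}`. [folklore] -/
def XF (t : D.Sec d) : Y.Opens := ⨆ i, Y.basicOpen (t.val i)

/-- Membership in the non-vanishing locus. [folklore] -/
theorem mem_XF_iff (t : D.Sec d) (x : Y) : x ∈ D.XF t ↔ t.Nonvanishing x := by
  rw [XF, Opens.mem_iSup]; rfl

/-- Each `Y_{t/sᵢ^d}` lies in `Y_t`. [folklore] -/
theorem basicOpen_val_le_XF (t : D.Sec d) (i : ι) : Y.basicOpen (t.val i) ≤ D.XF t :=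
  le_iSup (fun i => Y.basicOpen (t.val i)) i

/-- `Y_t ∩ U i = Y_{t/s_i^d}`. [folklore] -/
theorem XF_inf_U (t : D.Sec d) (i : ι) : D.XF t ⊓ D.U i = Y.basicOpen (t.val i) := by
  ext x
  constructor
  · rintro ⟨hx, hxi⟩
    exact (t.nonvanishing_iff hxi).mp ((D.mem_XF_iff t x).mp hx)
  · intro hx
    exact ⟨(D.mem_XF_iff t x).mpr ⟨i, hx⟩, Y.basicOpen_le _ hx⟩

/-- The non-vanishing locus only depends on the chart values. [folklore] -/
theorem XF_congr {e : ℕ} (t : D.Sec d) (t' : D.Sec e) (h : ∀ i, t.val i = t'.val i) :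
    D.XF t = D.XF t' := by
  simp only [XF, h]

/-- Transport along `cast` does not change the non-vanishing locus. [folklore] -/
@[simp] theorem XF_cast {e : ℕ} (h : d = e) (t : D.Sec d) : D.XF (t.cast h) = D.XF t := rfl

/-- The non-vanishing locus of `s_l^{⊗d}` (`d ≠ 0`) is `U l`. [folklore] -/
theorem XF_pow {l : ι} (hd : d ≠ 0) : D.XF (Sec.pow D l d) = D.U l := by
  ext x
  change x ∈ D.XF (Sec.pow D l d) ↔ x ∈ D.U l
  rw [mem_XF_iff]
  exact ⟨Sec.mem_U_of_nonvanishing_pow hd, fun h => Sec.nonvanishing_pow h d⟩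

/-- The non-vanishing locus of the monomial `sᵢ^{⊗M}` (`M ≠ 0`) is `U i`. [folklore] -/
theorem XF_monomial_single [Fintype ι] [DecidableEq ι] (i : ι) {M : ℕ} (hM : M ≠ 0) :
    D.XF (Sec.monomial D (Pi.single i M)) = D.U i := by
  rw [D.XF_congr (Sec.monomial D (Pi.single i M)) (Sec.pow D i M)
    (fun j => Sec.monomial_single_val i M j)]
  exact D.XF_pow hM

variable (t t₀ : D.Sec d) (Ω : Y.Opens) (hΩ : Ω ≤ D.XF t₀)

/-- The pieces `Ω ∩ Y_{t₀/sᵢ^d}` of an open `Ω ⊆ Y_{t₀}`. [folklore] -/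
abbrev piece (i : ι) : Y.Opens := Ω ⊓ Y.basicOpen (t₀.val i)

/-- The pieces lie in `Ω`. [folklore] -/
theorem piece_le (i : ι) : D.piece t₀ Ω i ≤ Ω := inf_le_left

/-- The `i`-th piece lies in `U i`. [folklore] -/
theorem piece_le_U (i : ι) : D.piece t₀ Ω i ≤ D.U i :=
  inf_le_right.trans (Y.basicOpen_le _)

include hΩ in
/-- The pieces cover `Ω`. [folklore] -/
theorem iSup_piece : ⨆ i, D.piece t₀ Ω i = Ω := by
  apply le_antisymm (iSup_le fun i => inf_le_left)
  intro x hx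
  obtain ⟨i, hi⟩ := (D.mem_XF_iff t₀ x).mp (hΩ hx)
  exact Opens.mem_iSup.mpr ⟨i, hx, hi⟩

/-- `t₀/sᵢ^d` is a unit on the `i`-th piece. [folklore] -/
theorem isUnit_rs_piece (i : ι) : IsUnit (rs (D.piece_le_U t₀ Ω i) (t₀.val i)) :=
  isUnit_rs_of_le_basicOpen _ inf_le_right

/-- The local quotients `(t/sᵢ^d) · (t₀/sᵢ^d)⁻¹` on the pieces. [folklore] -/
def quotPiece (i : ι) : Γ(Y, D.piece t₀ Ω i) :=
  rs (D.piece_le_U t₀ Ω i) (t.val i) * ↑(D.isUnit_rs_piece t₀ Ω i).unit⁻¹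

/-- The defining relation of the local quotient. [folklore] -/
theorem quotPiece_mul (i : ι) :
    D.quotPiece t t₀ Ω i * rs (D.piece_le_U t₀ Ω i) (t₀.val i) =
      rs (D.piece_le_U t₀ Ω i) (t.val i) := by
  rw [quotPiece, mul_assoc, IsUnit.val_inv_mul, mul_one]

/-- The local quotients agree on overlaps of the pieces. [folklore] -/
theorem quotPiece_compat (i j : ι) :
    rs (inf_le_left : D.piece t₀ Ω i ⊓ D.piece t₀ Ω j ≤ _) (D.quotPiece t t₀ Ω i) =
      rs (inf_le_right : D.piece t₀ Ω i ⊓ D.piece t₀ Ω j ≤ _) (D.quotPiece t t₀ Ω j) := by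
  -- on the overlap, `t/s_j^d = (t/s_i^d) r^d` and `t₀/s_j^d = (t₀/s_i^d) r^d`, `r = s_i/s_j`
  set W := D.piece t₀ Ω i ⊓ D.piece t₀ Ω j with hW
  have hWV : W ≤ D.V i j := by
    rw [D.V_eq]; exact le_inf (inf_le_left.trans (D.piece_le_U t₀ Ω i))
      (inf_le_right.trans (D.piece_le_U t₀ Ω j))
  have hu₀i : IsUnit (rs (inf_le_left.trans (D.piece_le_U t₀ Ω i) : W ≤ D.U i) (t₀.val i)) :=
    isUnit_rs_of_le_basicOpen _ (inf_le_left.trans inf_le_right)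
  have hu₀j : IsUnit (rs (inf_le_right.trans (D.piece_le_U t₀ Ω j) : W ≤ D.U j) (t₀.val j)) :=
    isUnit_rs_of_le_basicOpen _ (inf_le_right.trans inf_le_right)
  -- multiply the goal by the unit `t₀/s_j^d` (restricted)
  refine (hu₀j.mul_left_inj).mp ?_
  have ej := congrArg (rs hWV) (t.compat i j)
  have e₀j := congrArg (rs hWV) (t₀.compat i j)
  simp only [map_mul, map_pow, rs_rs] at ej e₀j
  have hqi := congrArg (rs (inf_le_left : W ≤ D.piece t₀ Ω i)) (D.quotPiece_mul t t₀ Ω i)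
  have hqj := congrArg (rs (inf_le_right : W ≤ D.piece t₀ Ω j)) (D.quotPiece_mul t t₀ Ω j)
  simp only [map_mul, rs_rs] at hqi hqj
  rw [rs_congr _ (inf_le_right.trans (D.piece_le_U t₀ Ω j)) (t₀.val j)] at hqj ⊢
  rw [hqj, ej, e₀j, ← mul_assoc, rs_congr _ (inf_le_left.trans (D.piece_le_U t₀ Ω i)) (t₀.val i),
    hqi]

include hΩ in
/-- **The quotient `t/t₀` of two sections of `𝓛^{⊗d}` on an open `Ω` where `t₀` does not
vanish**, glued from the local quotients `(t/sᵢ^d)(t₀/sᵢ^d)⁻¹`. [folklore] -/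
theorem exists_quot : ∃! q : Γ(Y, Ω), ∀ i, rs (D.piece_le t₀ Ω i) q = D.quotPiece t t₀ Ω i :=
  TopCat.Sheaf.existsUnique_gluing' Y.sheaf (D.piece t₀ Ω) Ω (fun i => homOfLE (D.piece_le t₀ Ω i))
    (le_of_eq (D.iSup_piece t₀ Ω hΩ).symm) (D.quotPiece t t₀ Ω) (D.quotPiece_compat t t₀ Ω)

/-- The quotient `t/t₀ ∈ Γ(Y, Ω)` (see `exists_quot`). [folklore] -/
def quot : Γ(Y, Ω) := (D.exists_quot t t₀ Ω hΩ).choose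

/-- The quotient restricts to the local quotients. [folklore] -/
theorem rs_quot (i : ι) : rs (D.piece_le t₀ Ω i) (D.quot t t₀ Ω hΩ) = D.quotPiece t t₀ Ω i :=
  (D.exists_quot t t₀ Ω hΩ).choose_spec.1 i

/-- Sections on `Ω` agreeing on all pieces are equal. [folklore] -/
theorem eq_of_rs_piece_eq {Ω' : Y.Opens} (hΩ' : Ω' ≤ D.XF t₀) (q q' : Γ(Y, Ω'))
    (h : ∀ i, rs (D.piece_le t₀ Ω' i) q = rs (D.piece_le t₀ Ω' i) q') : q = q' :=
  TopCat.Sheaf.eq_of_locally_eq' Y.sheaf (D.piece t₀ Ω') Ω' (fun i => homOfLE (D.piece_le t₀ Ω' i))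
    (le_of_eq (D.iSup_piece t₀ Ω' hΩ').symm) q q' h

/-- The defining property of the quotient: `(t/t₀) · (t₀/sᵢ^d) = t/sᵢ^d` on the `i`-th
piece. [folklore] -/
theorem quot_mul (i : ι) :
    rs (D.piece_le t₀ Ω i) (D.quot t t₀ Ω hΩ) * rs (D.piece_le_U t₀ Ω i) (t₀.val i) =
      rs (D.piece_le_U t₀ Ω i) (t.val i) := by
  rw [rs_quot, quotPiece_mul]

/-- `t₀/t₀ = 1`. [folklore] -/
theorem quot_self : D.quot t₀ t₀ Ω hΩ = 1 := by
  refine D.eq_of_rs_piece_eq t₀ hΩ _ _ fun i => ?_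
  rw [map_one]
  refine ((D.isUnit_rs_piece t₀ Ω i).mul_left_inj).mp ?_
  rw [quot_mul, one_mul]

/-- Restriction of the quotient to a smaller open. [folklore] -/
theorem rs_quot_of_le {Ω' : Y.Opens} (h : Ω' ≤ Ω) :
    rs h (D.quot t t₀ Ω hΩ) = D.quot t t₀ Ω' (h.trans hΩ) := by
  refine D.eq_of_rs_piece_eq t₀ (h.trans hΩ) _ _ fun i => ?_
  have hp : D.piece t₀ Ω' i ≤ D.piece t₀ Ω i := inf_le_inf_right _ h
  refine ((D.isUnit_rs_piece t₀ Ω' i).mul_left_inj).mp ?_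
  rw [quot_mul, rs_rs]
  have := congrArg (rs hp) (D.quot_mul t t₀ Ω hΩ i)
  simp only [map_mul, rs_rs] at this
  exact this

include hΩ in
/-- `Ω ∩ U i` is the `i`-th piece: on `U i` the section `t₀` does not vanish exactly where
`t₀/sᵢ^d` does not. [folklore] -/
theorem inf_U_eq_piece (i : ι) : Ω ⊓ D.U i = D.piece t₀ Ω i := by
  ext x
  constructor
  · rintro ⟨hx, hxi⟩
    exact ⟨hx, (t₀.nonvanishing_iff hxi).mp ((D.mem_XF_iff t₀ x).mp (hΩ hx))⟩
  · rintro ⟨hx, hxi⟩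
    exact ⟨hx, Y.basicOpen_le _ hxi⟩

/-- **The non-vanishing locus of the quotient** `t/t₀` on `Ω` is `Ω ∩ Y_t`. [folklore] -/
theorem basicOpen_quot : Y.basicOpen (D.quot t t₀ Ω hΩ) = Ω ⊓ D.XF t := by
  ext x
  constructor
  · intro hx
    have hxΩ : x ∈ Ω := Y.basicOpen_le _ hx
    obtain ⟨i, hi⟩ := (D.mem_XF_iff t₀ x).mp (hΩ hxΩ)
    have hxp : x ∈ D.piece t₀ Ω i := ⟨hxΩ, hi⟩
    have h1 : x ∈ Y.basicOpen (rs (D.piece_le t₀ Ω i) (D.quot t t₀ Ω hΩ)) := by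
      rw [basicOpen_rs]; exact ⟨hxp, hx⟩
    have h2 : x ∈ Y.basicOpen (rs (D.piece_le t₀ Ω i) (D.quot t t₀ Ω hΩ) *
        rs (D.piece_le_U t₀ Ω i) (t₀.val i)) := by
      rw [Scheme.basicOpen_mul]; exact ⟨h1, by rw [basicOpen_rs]; exact ⟨hxp, hi⟩⟩
    rw [quot_mul, basicOpen_rs] at h2
    exact ⟨hxΩ, (D.mem_XF_iff t x).mpr ⟨i, h2.2⟩⟩
  · rintro ⟨hxΩ, hxt⟩
    obtain ⟨i, hi⟩ := (D.mem_XF_iff t₀ x).mp (hΩ hxΩ)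
    have hxp : x ∈ D.piece t₀ Ω i := ⟨hxΩ, hi⟩
    have hxi : x ∈ D.U i := Y.basicOpen_le _ hi
    have h2 : x ∈ Y.basicOpen (rs (D.piece_le_U t₀ Ω i) (t.val i)) := by
      rw [basicOpen_rs]
      exact ⟨hxp, (t.nonvanishing_iff hxi).mp ((D.mem_XF_iff t x).mp hxt)⟩
    rw [← quot_mul, Scheme.basicOpen_mul, basicOpen_rs] at h2
    exact h2.1.2

/-- **Change of denominator**: `t/t₂ = (t₁/t₂) · (t/t₁)` on `Ω₁ ∩ Ω₂`. [folklore] -/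
theorem quot_trans (t t₁ t₂ : D.Sec d) (Ω₁ Ω₂ : Y.Opens) (h₁ : Ω₁ ≤ D.XF t₁) (h₂ : Ω₂ ≤ D.XF t₂) :
    D.quot t t₂ (Ω₁ ⊓ Ω₂) (inf_le_right.trans h₂) =
      D.quot t₁ t₂ (Ω₁ ⊓ Ω₂) (inf_le_right.trans h₂) *
        D.quot t t₁ (Ω₁ ⊓ Ω₂) (inf_le_left.trans h₁) := by
  set Ω := Ω₁ ⊓ Ω₂ with hΩ₀
  have hΩ1 : Ω ≤ D.XF t₁ := inf_le_left.trans h₁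
  have hΩ2 : Ω ≤ D.XF t₂ := inf_le_right.trans h₂
  -- the cover of `Ω` by `R i = Ω ∩ Y_{t₂/sᵢ} ∩ Y_{t₁/sᵢ}`
  let R : ι → Y.Opens := fun i => D.piece t₂ Ω i ⊓ Y.basicOpen (t₁.val i)
  have hR : ∀ i, R i ≤ Ω := fun i => inf_le_left.trans (D.piece_le t₂ Ω i)
  have hRU : ∀ i, R i ≤ D.U i := fun i => inf_le_left.trans (D.piece_le_U t₂ Ω i)
  have hcov : Ω ≤ iSup R := by
    intro x hx
    obtain ⟨i, hi⟩ := (D.mem_XF_iff t₂ x).mp (hΩ2 hx)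
    have hxi : x ∈ D.U i := Y.basicOpen_le _ hi
    have h1 : x ∈ Y.basicOpen (t₁.val i) :=
      (t₁.nonvanishing_iff hxi).mp ((D.mem_XF_iff t₁ x).mp (hΩ1 hx))
    exact Opens.mem_iSup.mpr ⟨i, ⟨hx, hi⟩, h1⟩
  refine TopCat.Sheaf.eq_of_locally_eq' Y.sheaf R Ω (fun i => homOfLE (hR i)) hcov _ _ fun i => ?_
  change rs (hR i) (D.quot t t₂ Ω hΩ2) = rs (hR i) (D.quot t₁ t₂ Ω hΩ2 * D.quot t t₁ Ω hΩ1)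
  -- the three defining relations, restricted to `R i`
  have u₂ : IsUnit (rs (hRU i) (t₂.val i)) :=
    isUnit_rs_of_le_basicOpen _ (inf_le_left.trans inf_le_right)
  have u₁ : IsUnit (rs (hRU i) (t₁.val i)) := isUnit_rs_of_le_basicOpen _ inf_le_right
  have e₂ := congrArg (rs (inf_le_left : R i ≤ D.piece t₂ Ω i)) (D.quot_mul t t₂ Ω hΩ2 i)
  have e₁₂ := congrArg (rs (inf_le_left : R i ≤ D.piece t₂ Ω i)) (D.quot_mul t₁ t₂ Ω hΩ2 i)
  have hR₁ : R i ≤ D.piece t₁ Ω i := le_inf (hR i) inf_le_right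
  have e₁ := congrArg (rs hR₁) (D.quot_mul t t₁ Ω hΩ1 i)
  simp only [map_mul, rs_rs] at e₂ e₁₂ e₁
  refine (u₂.mul_left_inj).mp ((u₁.mul_left_inj).mp ?_)
  rw [map_mul]
  calc rs (hR i) (D.quot t t₂ Ω hΩ2) * rs (hRU i) (t₂.val i) * rs (hRU i) (t₁.val i)
      = rs (hRU i) (t.val i) * rs (hRU i) (t₁.val i) := by rw [e₂]
    _ = (rs (hR i) (D.quot t₁ t₂ Ω hΩ2) * rs (hRU i) (t₂.val i)) *
          (rs (hR i) (D.quot t t₁ Ω hΩ1) * rs (hRU i) (t₁.val i)) := by rw [e₁₂, e₁, mul_comm]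
    _ = rs (hR i) (D.quot t₁ t₂ Ω hΩ2) * rs (hR i) (D.quot t t₁ Ω hΩ1) *
          rs (hRU i) (t₂.val i) * rs (hRU i) (t₁.val i) := by ring

end Quot

/-! ### A section of positive degree non-vanishing on a finite set (graded prime avoidance) -/

section Avoid

variable [Finite ι] (hU : ∀ i, IsAffineOpen (D.U i))
include hU

omit D [Finite ι] hU in
/-- In an affine chart `U`, membership of a point in a basic open is non-membership of the
function in the corresponding prime. [folklore] -/
theorem mem_basicOpen_iff_notMem_primeIdealOf {U : Y.Opens} (hU' : IsAffineOpen U) (f : Γ(Y, U))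
    (x : U) : (x : Y) ∈ Y.basicOpen f ↔ f ∉ (hU'.primeIdealOf x).asIdeal := by
  have h1 : (x : Y) ∈ Y.basicOpen f ↔ hU'.primeIdealOf x ∈ hU'.fromSpec ⁻¹ᵁ Y.basicOpen f := by
    change _ ↔ hU'.fromSpec (hU'.primeIdealOf x) ∈ Y.basicOpen f
    rw [hU'.fromSpec_primeIdealOf]
  rw [h1, hU'.fromSpec_preimage_basicOpen]
  exact PrimeSpectrum.mem_basicOpen (R := Γ(Y, U)) f (hU'.primeIdealOf x)

omit [Finite ι] hU in
/-- Two distinct points neither of which specialises to the other are separated by a section of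
some `𝓛^{⊗e}`: one that vanishes at the second but not at the first. [folklore] -/
theorem exists_sec_separating [Finite ι] (hU : ∀ i, IsAffineOpen (D.U i)) {a b : Y}
    (hab : ¬ b ⤳ a) : ∃ (e : ℕ) (q : D.Sec e), q.Nonvanishing a ∧ ¬q.Nonvanishing b := by
  obtain ⟨i, ha⟩ := D.exists_index_mem_U a
  by_cases hb : b ∈ D.U i
  · -- separate inside the affine chart `U i`
    set pa := (hU i).primeIdealOf ⟨a, ha⟩ with hpa
    set pb := (hU i).primeIdealOf ⟨b, hb⟩ with hpb
    have hle : ¬pb.asIdeal ≤ pa.asIdeal := by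
      intro h
      rw [PrimeSpectrum.asIdeal_le_asIdeal, PrimeSpectrum.le_iff_specializes] at h
      have h' := h.map (hU i).fromSpec.continuous
      rw [(hU i).fromSpec_primeIdealOf, (hU i).fromSpec_primeIdealOf] at h'
      exact hab h'
    obtain ⟨f, hfb, hfa⟩ := SetLike.not_le_iff_exists.mp hle
    obtain ⟨e, q, hq⟩ := D.exists_sec_val_eq hU i f
    refine ⟨e, q, ?_, ?_⟩
    · rw [q.nonvanishing_iff ha, hq, mem_basicOpen_iff_notMem_primeIdealOf (hU i) f ⟨a, ha⟩]
      exact hfa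
    · rw [q.nonvanishing_iff hb, hq, mem_basicOpen_iff_notMem_primeIdealOf (hU i) f ⟨b, hb⟩,
        not_not]
      exact hfb
  · exact ⟨1, Sec.pow D i 1, Sec.nonvanishing_pow ha 1,
      fun h => hb (Sec.mem_U_of_nonvanishing_pow one_ne_zero h)⟩

/-- **Graded prime avoidance**: for a finite set `S` of points no two of which are
specialisations of each other, there is a section of some `𝓛^{⊗d}`, `d > 0`, vanishing at no
point of `S`. (For each `a ∈ S` multiply sections vanishing at the other points but not at `a`,
and `sₐ`; bring to a common degree; add up.) [folklore] -/
theorem exists_sec_nonvanishing (S : Finset Y) (hS : ∀ a ∈ S, ∀ b ∈ S, b ⤳ a → b = a) :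
    ∃ d : ℕ, 0 < d ∧ ∃ t : D.Sec d, ∀ x ∈ S, t.Nonvanishing x := by
  classical
  haveI := Fintype.ofFinite ι
  choose ch hch using D.exists_index_mem_U (Y := Y)
  -- pairwise separating sections, of a common degree `N`
  let Pairs := {p : S × S // p.1 ≠ p.2}
  have hsep : ∀ p : Pairs, ∃ (e : ℕ) (q : D.Sec e),
      q.Nonvanishing (p.1.1 : Y) ∧ ¬q.Nonvanishing (p.1.2 : Y) := fun p =>
    D.exists_sec_separating hU fun h => p.2 (Subtype.ext (hS _ p.1.1.2 _ p.1.2.2 h)).symm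
  choose e q hq using hsep
  let N : ℕ := Finset.univ.sup e
  have heN : ∀ p, e p ≤ N := fun p => Finset.le_sup (Finset.mem_univ p)
  let q' : Pairs → D.Sec N := fun p =>
    ((q p).mul (Sec.pow D (ch p.1.1) (N - e p))).cast (Nat.add_sub_cancel' (heN p))
  have hq'1 : ∀ p, (q' p).Nonvanishing (p.1.1 : Y) := fun p => by
    simp only [q', Sec.nonvanishing_cast_iff, Sec.nonvanishing_mul_iff]
    exact ⟨(hq p).1, Sec.nonvanishing_pow (hch _) _⟩
  have hq'2 : ∀ p, ¬(q' p).Nonvanishing (p.1.2 : Y) := fun p => by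
    simp only [q', Sec.nonvanishing_cast_iff, Sec.nonvanishing_mul_iff, not_and]
    exact fun h => absurd h (hq p).2
  -- the products `P a = ∏_{b ≠ a} q'(a, b)`
  let pr : ∀ a : S, {b // b ∈ S.erase a} → Pairs := fun a b =>
    ⟨(a, ⟨b.1, (Finset.mem_erase.mp b.2).2⟩), fun h => (Finset.mem_erase.mp b.2).1 congr(($h).1).symm⟩
  let P : ∀ a : S, D.Sec (N * (S.erase a).attach.card) := fun a =>
    Sec.prod (S.erase a).attach fun b => q' (pr a b)
  have hcard : ∀ a : S, N * (S.erase a).attach.card = N * (S.card - 1) := fun a => by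
    rw [Finset.card_attach, Finset.card_erase_of_mem a.2]
  let P' : S → D.Sec (N * (S.card - 1) + 1) := fun a =>
    ((P a).cast (hcard a)).mul (Sec.pow D (ch a) 1)
  refine ⟨N * (S.card - 1) + 1, Nat.succ_pos _, Sec.sum S.attach P', fun b hb => ?_⟩
  refine Sec.nonvanishing_sum_of_unique _ _ _ ⟨b, hb⟩ (Finset.mem_attach _ _) ?_ ?_
  · simp only [P', P, Sec.nonvanishing_mul_iff, Sec.nonvanishing_cast_iff,
      Sec.nonvanishing_prod_iff]
    exact ⟨fun c _ => hq'1 (pr ⟨b, hb⟩ c), Sec.nonvanishing_pow (hch b) 1⟩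
  · intro a _ hab
    simp only [P', P, Sec.nonvanishing_mul_iff, Sec.nonvanishing_cast_iff,
      Sec.nonvanishing_prod_iff, not_and]
    intro h
    have hba : b ∈ S.erase (a : Y) :=
      Finset.mem_erase.mpr ⟨fun h' => hab (Subtype.ext h'.symm), hb⟩
    exact absurd (h ⟨b, hba⟩ (Finset.mem_attach _ _)) (hq'2 (pr a ⟨b, hba⟩))

end Avoid

end GeneratingSections

end Literature.AlgebraicGeometry.Motives
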